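import Summits.HubbardSuperconductivity.HubbardSuperconductivity.Theorems.ChiralWindowCwThesisPenaltyEquivalence
import Summits.HubbardSuperconductivity.HubbardSuperconductivity.Theorems.TwSeededEnsembleEquivalence.Negative.SeedLeverage
import Literature.MathematicalPhysics.QuantumLattice.FinDimSpectrumSectorGibbsLimit
import HarnessLib

/-!
# Route `ChiralWindow`, crux `CwThesis` (stmt-HubbardSuperconductivity-10438), line `SketchIdeator3`:
# the engine in ENERGY-WINDOW normal form

The disprover's normal form of the crux (`CwThesis.Negative.cwThesis_iff_floor`, §5 of
`Cruxes/CwThesis/Disproof.lean`) reads: `X` iff for all small `U` there are `δ_U` in the window and `a > 0`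
with, eventually along the even sides, a pair-intensity floor `a L⁴ ≤ re ⟨ψ, Δ_d†Δ_d ψ⟩` for EVERY normalised
sector GROUND STATE `ψ`. This file proves the matching normal form of the ENGINE of line `SketchIdeator3`
(equivalently, by `gibbsPenaltyFloor_iff_penaltyResponseWindow`, of the `T = 0` penalty-response family C⁺):

  C⁺ iff for all small `U` there are `δ_U` in the window, an INTENSIVE energy width `w > 0` and `a > 0` with,
  eventually along `L = 2(k+1)`, the floor `a L⁴ ≤ re ⟨ψ, Δ_d†Δ_d ψ⟩` for EVERY normalised `ψ` of the sector
  whose energy is within `w` of the sector ground energy, `re ⟨ψ, H ψ⟩ ≤ E_L(U;0) + w`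
  (`penaltyResponseWindow_iff_energyWindowFloor`).

So the exact price of the penalty line over the crux is `w = 0` (ground states) versus `w > 0` (an `O(1)`
energy window above the ground energy, `L`-independent): stability of the `d`-wave floor under bounded-energy
excitations. Mechanism (finite-dimensional, folklore): an intensive penalty `(κ/L⁴) Q` with `‖Q‖ ≤ (c_d L²)²`
moves sector energies by at most `κ c_d²`, so approximate minimisers of the penalised problem live in the window
`w = κ c_d² + ε` (`smul_le_minEnergyOn_add_smul_sub`), and conversely a response `c κ` forces the floor `c - w/κ`
on the window of width `w` (`le_re_rayleigh_of_minEnergyOn_add_smul_sub`, the chord inequality with slack).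
Corollary: `cwThesis_of_energyWindowFloor` (the window floor ⇒ the crux), the line's most transparent entry point.
Tasaki (2020) §2.1–2.2; Griffiths (1966). No definition is introduced.
-/

noncomputable section

namespace Summit.HubbardSuperconductivity.HubbardSuperconductivity.Theorems.CwThesis

-- `Summit.HubbardSuperconductivity.HubbardSuperconductivity.…` repeats the summit name by design (D-0017 layout)
set_option linter.dupNamespace false
-- `DecidableEq {s : Finset (Orb Λ) // …}` (the `(n,n)`-block index of the engine statement) exceeds the default budget
set_option synthInstance.maxSize 512

open Matrix Filter Literature.MathematicalPhysics.QuantumLattice Literature.Probability.LatticeModels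
open Summit.HubbardSuperconductivity.HubbardSuperconductivity.Theses
open scoped ComplexOrder Matrix.Norms.L2Operator

/-! ### Abstract: intensive penalties and energy windows -/

section Abstract

variable {ι : Type*} [Fintype ι] [DecidableEq ι]

omit [DecidableEq ι] in
/-- The Rayleigh quotient of `H + t • Q` splits. [folklore] -/
theorem re_rayleigh_add_smul (H Q : Matrix ι ι ℂ) (t : ℝ) (ψ : ι → ℂ) :
    (star ψ ⬝ᵥ (H + (t : ℂ) • Q) *ᵥ ψ).re = (star ψ ⬝ᵥ H *ᵥ ψ).re + t * (star ψ ⬝ᵥ Q *ᵥ ψ).re := by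
  rw [add_mulVec, smul_mulVec, dotProduct_add, dotProduct_smul, Complex.add_re, smul_eq_mul,
    Complex.re_ofReal_mul]

/-- **Response ⇒ window floor (chord inequality with slack).** For Hermitian `H`, `Q`, a subspace `K`,
`t > 0` and a response `c t ≤ minEnergyOn (H + tQ) K - minEnergyOn H K`: every unit `ψ ∈ K` with
`re ⟨ψ, Hψ⟩ ≤ minEnergyOn H K + w` has `c - w / t ≤ re ⟨ψ, Qψ⟩` (`ψ` is a trial state for `H + tQ`). [folklore] -/
theorem le_re_rayleigh_of_minEnergyOn_add_smul_sub {H Q : Matrix ι ι ℂ} (hH : H.IsHermitian)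
    (hQ : Q.IsHermitian) (K : Submodule ℂ (ι → ℂ)) {t c w : ℝ} (ht : 0 < t)
    (hresp : c * t ≤ (H + (t : ℂ) • Q).minEnergyOn K - H.minEnergyOn K)
    {ψ : ι → ℂ} (hψK : ψ ∈ K) (hψ1 : star ψ ⬝ᵥ ψ = 1)
    (hwin : (star ψ ⬝ᵥ H *ᵥ ψ).re ≤ H.minEnergyOn K + w) :
    c - w / t ≤ (star ψ ⬝ᵥ Q *ᵥ ψ).re := by
  have hHt : (H + (t : ℂ) • Q).IsHermitian := hH.add (IsHermitian.smul hQ (Complex.conj_ofReal t))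
  have hle := minEnergyOn_le_rayleigh_of_mem hHt K hψK hψ1
  rw [re_rayleigh_add_smul] at hle
  have key : c * t - w ≤ t * (star ψ ⬝ᵥ Q *ᵥ ψ).re := by linarith
  calc c - w / t = (c * t - w) / t := by field_simp
    _ ≤ (star ψ ⬝ᵥ Q *ᵥ ψ).re := by rw [div_le_iff₀ ht]; linarith

/-- **Window floor ⇒ response (intensive penalties only see an `O(‖penalty‖)` energy window).** For Hermitian
`H`, `Q` with `0 ≤ re ⟨ψ, Qψ⟩ ≤ B` on unit vectors, a subspace `K` containing a unit vector, `t ≥ 0` and a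
width `w` with `t B < w`: if every unit `ψ ∈ K` with `re ⟨ψ, Hψ⟩ ≤ minEnergyOn H K + w` has `C ≤ re ⟨ψ, Qψ⟩`,
then `t C ≤ minEnergyOn (H + tQ) K - minEnergyOn H K` (approximate minimisers of `H + tQ` on `K` lie in the
window, since `minEnergyOn (H + tQ) K ≤ minEnergyOn H K + t B`). [folklore] -/
theorem smul_le_minEnergyOn_add_smul_sub {H Q : Matrix ι ι ℂ} (hH : H.IsHermitian) (hQ : Q.IsHermitian)
    (K : Submodule ℂ (ι → ℂ)) (hK : ∃ φ ∈ K, star φ ⬝ᵥ φ = 1) {B t w C : ℝ}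
    (hQ0 : ∀ ψ : ι → ℂ, 0 ≤ (star ψ ⬝ᵥ Q *ᵥ ψ).re)
    (hQB : ∀ ψ : ι → ℂ, star ψ ⬝ᵥ ψ = 1 → (star ψ ⬝ᵥ Q *ᵥ ψ).re ≤ B)
    (ht : 0 ≤ t) (htB : t * B < w)
    (hfloor : ∀ ψ ∈ K, star ψ ⬝ᵥ ψ = 1 → (star ψ ⬝ᵥ H *ᵥ ψ).re ≤ H.minEnergyOn K + w →
      C ≤ (star ψ ⬝ᵥ Q *ᵥ ψ).re) :
    t * C ≤ (H + (t : ℂ) • Q).minEnergyOn K - H.minEnergyOn K := by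
  have hHt : (H + (t : ℂ) • Q).IsHermitian := hH.add (IsHermitian.smul hQ (Complex.conj_ofReal t))
  -- the two Rayleigh sets
  set R0 : Set ℝ := {E : ℝ | ∃ ψ ∈ K, star ψ ⬝ᵥ ψ = 1 ∧ E = (star ψ ⬝ᵥ H *ᵥ ψ).re} with hR0
  set Rt : Set ℝ := {E : ℝ | ∃ ψ ∈ K, star ψ ⬝ᵥ ψ = 1 ∧ E = (star ψ ⬝ᵥ (H + (t : ℂ) • Q) *ᵥ ψ).re}
    with hRt
  have hE0 : H.minEnergyOn K = sInf R0 := rfl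
  have hEt : (H + (t : ℂ) • Q).minEnergyOn K = sInf Rt := rfl
  obtain ⟨φ, hφK, hφ1⟩ := hK
  have hR0ne : R0.Nonempty := ⟨_, φ, hφK, hφ1, rfl⟩
  have hRtne : Rt.Nonempty := ⟨_, φ, hφK, hφ1, rfl⟩
  -- `E(t) ≤ E(0) + t B`
  have hEt_le : (H + (t : ℂ) • Q).minEnergyOn K - t * B ≤ H.minEnergyOn K := by
    rw [hE0]
    refine le_csInf hR0ne ?_
    rintro E ⟨ψ, hψK, hψ1, rfl⟩
    have h1 := minEnergyOn_le_rayleigh_of_mem hHt K hψK hψ1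
    rw [re_rayleigh_add_smul] at h1
    have h2 : t * (star ψ ⬝ᵥ Q *ᵥ ψ).re ≤ t * B := mul_le_mul_of_nonneg_left (hQB ψ hψ1) ht
    linarith
  -- approximate minimisers of `H + tQ` lie in the window
  refine le_of_forall_pos_lt_add fun ε hε => ?_
  have hε' : 0 < min ε (w - t * B) := lt_min hε (by linarith)
  have hlt : sInf Rt < (H + (t : ℂ) • Q).minEnergyOn K + min ε (w - t * B) := by
    rw [hEt]; linarith
  obtain ⟨E, ⟨ψ, hψK, hψ1, rfl⟩, hEψ⟩ := exists_lt_of_csInf_lt hRtne hlt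
  rw [re_rayleigh_add_smul] at hEψ
  have hmin1 : min ε (w - t * B) ≤ ε := min_le_left _ _
  have hmin2 : min ε (w - t * B) ≤ w - t * B := min_le_right _ _
  have htq : 0 ≤ t * (star ψ ⬝ᵥ Q *ᵥ ψ).re := mul_nonneg ht (hQ0 ψ)
  have hwin : (star ψ ⬝ᵥ H *ᵥ ψ).re ≤ H.minEnergyOn K + w := by linarith
  have hC := hfloor ψ hψK hψ1 hwin
  have hlow := minEnergyOn_le_rayleigh_of_mem hH K hψK hψ1
  have htC : t * C ≤ t * (star ψ ⬝ᵥ Q *ᵥ ψ).re := mul_le_mul_of_nonneg_left hC ht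
  linarith

/-- The Rayleigh quotient of a unit vector is bounded by the operator norm. [folklore] -/
theorem re_rayleigh_le_norm (Q : Matrix ι ι ℂ) {ψ : ι → ℂ} (hψ1 : star ψ ⬝ᵥ ψ = 1) :
    (star ψ ⬝ᵥ Q *ᵥ ψ).re ≤ ‖Q‖ := by
  refine (Complex.re_le_norm _).trans ((norm_star_dotProduct_le_eucNorm hψ1 _).trans ?_)
  have h := eucNorm_mulVec_le Q ψ
  rwa [eucNorm_eq_one hψ1, mul_one] at h

end Abstract

/-! ### The torus: unit vectors of the sector and the norm of the pair intensity
(the sign `0 ≤ re ⟨ψ, Δ_d†Δ_d ψ⟩` is `TwSeededEnsembleEquivalence.Negative.re_rayleigh_seed_nonneg`) -/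

/-- Lieb's `(2n, 0)` sector of the torus of side `L` contains a unit vector when `n ≤ L²` (the basis vector of
`pairSet α α` for an `n`-subset `α` of the sites). [folklore] -/
theorem exists_unit_mem_szSector (L : ℕ) {n : ℕ} (hn : n ≤ L ^ 2) :
    ∃ φ ∈ szSector (Λ := FermionTorus 2 L) (2 * n) 0, star φ ⬝ᵥ φ = 1 := by
  have hcardT : Fintype.card (FermionTorus 2 L) = L ^ 2 := by simp [FermionTorus, Fintype.card_lex]
  obtain ⟨α, -, hα⟩ := Finset.exists_subset_card_eq (s := (Finset.univ : Finset (FermionTorus 2 L)))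
    (n := n) (by rw [Finset.card_univ, hcardT]; exact hn)
  refine ⟨Pi.single (pairSet α α) 1, ?_, by simp⟩
  rw [mem_szSector_two_mul_zero_iff]
  intro s hs
  rw [Pi.single_apply, if_neg]
  rintro rfl
  exact hs ⟨by rw [upPart_pairSet, hα], by rw [downPart_pairSet, hα]⟩

/-- `‖Δ_d†Δ_d‖ ≤ (c_d L²)²` on the torus of side `L ≠ 0`. [folklore] -/
theorem norm_pairIntensity_le (L : ℕ) [NeZero L] :
    ‖(pairField dWaveFormFactor L)ᴴ * pairField dWaveFormFactor L‖ ≤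
      ((2 * ∑ e ∈ insert (0 : Site 2) unitSteps, |dWaveFormFactor e / Real.sqrt 2|) * (L : ℝ) ^ 2) ^ 2 := by
  rw [Matrix.l2_opNorm_conjTranspose_mul_self, sq]
  have h := norm_pairField_le dWaveFormFactor L
  exact mul_le_mul h h (norm_nonneg _) ((norm_nonneg _).trans h)

/-! ### The two families: C⁺ (penalty response) ⇔ the energy-window floor -/

/-- **C⁺ in energy-window normal form.** The `T = 0` penalty-response family (for every weak `U` a window
doping `δ_U` and `κ, c > 0` with, eventually along `L = 2(k+1)`, `c κ ≤ E_L(U;κ) - E_L(U;0)`) holds iff for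
every weak `U` there are a window doping `δ_U`, an intensive width `w > 0` and `a > 0` with, eventually along
`L = 2(k+1)`, the floor `a L⁴ ≤ re ⟨ψ, Δ_d†Δ_d ψ⟩` for EVERY unit `ψ` of the sector `(N_L, 0)` with
`re ⟨ψ, H_L ψ⟩ ≤ E_L(U;0) + w` (`H_L = hubbardTorus 2 L 1 U`, `E_L(U;0) = minEnergyOn H_L (szSector N_L 0)`).
Compare the crux itself: `X` iff the same floor for the sector GROUND STATES only (`w = 0`,
`CwThesis.Negative.cwThesis_iff_floor`). (`→`: `w := cκ/2`, `a := c/2`, chord inequality with slack;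
`←`: `κ := w/(2(c_d²+1))`, `c := a`, intensive penalties only see an `O(κ c_d²)` energy window.) [folklore] -/
theorem penaltyResponseWindow_iff_energyWindowFloor :
    (∃ U₀ : ℝ, 0 < U₀ ∧ ∀ U ∈ Set.Ioo (0:ℝ) U₀, ∃ δ ∈ Set.Icc (3/10 : ℝ) (12/25),
      ∃ κ : ℝ, 0 < κ ∧ ∃ c : ℝ, 0 < c ∧ ∀ᶠ k : ℕ in Filter.atTop,
        c * κ ≤ Matrix.minEnergyOn (hubbardTorus 2 (2 * (k + 1)) 1 U +
            ((κ / ((2 * (k + 1) : ℕ) : ℝ) ^ 4 : ℝ) : ℂ) •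
              ((pairField dWaveFormFactor (2 * (k + 1)))ᴴ * pairField dWaveFormFactor (2 * (k + 1))))
            (szSector (2 * ⌊(1 - δ) * ((2 * (k + 1) : ℕ) : ℝ) ^ 2 / 2⌋₊) 0) -
          Matrix.minEnergyOn (hubbardTorus 2 (2 * (k + 1)) 1 U)
            (szSector (2 * ⌊(1 - δ) * ((2 * (k + 1) : ℕ) : ℝ) ^ 2 / 2⌋₊) 0)) ↔
    (∃ U₀ : ℝ, 0 < U₀ ∧ ∀ U ∈ Set.Ioo (0:ℝ) U₀, ∃ δ ∈ Set.Icc (3/10 : ℝ) (12/25),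
      ∃ w : ℝ, 0 < w ∧ ∃ a : ℝ, 0 < a ∧ ∀ᶠ k : ℕ in Filter.atTop,
        ∀ ψ ∈ szSector (Λ := FermionTorus 2 (2 * (k + 1))) (2 * ⌊(1 - δ) * ((2 * (k + 1) : ℕ) : ℝ) ^ 2 / 2⌋₊) 0,
          star ψ ⬝ᵥ ψ = 1 →
          (star ψ ⬝ᵥ hubbardTorus 2 (2 * (k + 1)) 1 U *ᵥ ψ).re ≤
              Matrix.minEnergyOn (hubbardTorus 2 (2 * (k + 1)) 1 U)
                (szSector (2 * ⌊(1 - δ) * ((2 * (k + 1) : ℕ) : ℝ) ^ 2 / 2⌋₊) 0) + w →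
            a * ((2 * (k + 1) : ℕ) : ℝ) ^ 4 ≤
              (star ψ ⬝ᵥ ((pairField dWaveFormFactor (2 * (k + 1)))ᴴ *
                pairField dWaveFormFactor (2 * (k + 1))) *ᵥ ψ).re) := by
  constructor
  · rintro ⟨U₀, hU₀, hU⟩
    refine ⟨U₀, hU₀, fun U hUm => ?_⟩
    obtain ⟨δ, hδ, κ, hκ, c, hc, hev⟩ := hU U hUm
    refine ⟨δ, hδ, c * κ / 2, by positivity, c / 2, by positivity, ?_⟩
    filter_upwards [hev] with k hk ψ hψK hψ1 hwin
    have hLpos : (0 : ℝ) < ((2 * (k + 1) : ℕ) : ℝ) := by positivity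
    have hL4 : (0 : ℝ) < ((2 * (k + 1) : ℕ) : ℝ) ^ 4 := by positivity
    have ht : 0 < κ / ((2 * (k + 1) : ℕ) : ℝ) ^ 4 := by positivity
    -- the response in the form `(c L⁴) · (κ/L⁴) ≤ …`
    have hresp : c * ((2 * (k + 1) : ℕ) : ℝ) ^ 4 * (κ / ((2 * (k + 1) : ℕ) : ℝ) ^ 4) ≤
        Matrix.minEnergyOn (hubbardTorus 2 (2 * (k + 1)) 1 U +
            ((κ / ((2 * (k + 1) : ℕ) : ℝ) ^ 4 : ℝ) : ℂ) •
              ((pairField dWaveFormFactor (2 * (k + 1)))ᴴ * pairField dWaveFormFactor (2 * (k + 1))))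
            (szSector (2 * ⌊(1 - δ) * ((2 * (k + 1) : ℕ) : ℝ) ^ 2 / 2⌋₊) 0) -
          Matrix.minEnergyOn (hubbardTorus 2 (2 * (k + 1)) 1 U)
            (szSector (2 * ⌊(1 - δ) * ((2 * (k + 1) : ℕ) : ℝ) ^ 2 / 2⌋₊) 0) := by
      have : c * ((2 * (k + 1) : ℕ) : ℝ) ^ 4 * (κ / ((2 * (k + 1) : ℕ) : ℝ) ^ 4) = c * κ := by
        field_simp
      rw [this]; exact hk
    have key := le_re_rayleigh_of_minEnergyOn_add_smul_sub
      (hubbardTorus_isHermitian (hamiltonian_isHermitian_and_commute_holds _) 1 U)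
      (isHermitian_conjTranspose_mul_self _) _ ht hresp hψK hψ1 hwin
    have hconst : c * ((2 * (k + 1) : ℕ) : ℝ) ^ 4 - c * κ / 2 / (κ / ((2 * (k + 1) : ℕ) : ℝ) ^ 4) =
        c / 2 * ((2 * (k + 1) : ℕ) : ℝ) ^ 4 := by
      field_simp
      ring
    rw [hconst] at key
    exact key
  · rintro ⟨U₀, hU₀, hU⟩
    refine ⟨U₀, hU₀, fun U hUm => ?_⟩
    obtain ⟨δ, hδ, w, hw, a, ha, hev⟩ := hU U hUm
    set cd : ℝ := 2 * ∑ e ∈ insert (0 : Site 2) unitSteps, |dWaveFormFactor e / Real.sqrt 2| with hcd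
    have hB1 : 0 < cd ^ 2 + 1 := by positivity
    refine ⟨δ, hδ, w / (2 * (cd ^ 2 + 1)), by positivity, a, ha, ?_⟩
    filter_upwards [hev] with k hk
    have hδ0 : (0 : ℝ) ≤ δ := by linarith [hδ.1]
    have hLpos : (0 : ℝ) < ((2 * (k + 1) : ℕ) : ℝ) := by positivity
    have hL4 : (0 : ℝ) < ((2 * (k + 1) : ℕ) : ℝ) ^ 4 := by positivity
    -- `⌊(1-δ)L²/2⌋ ≤ L²` for `δ ≥ 0`, so the sector has a unit vector
    have hn : ⌊(1 - δ) * (((2 * (k + 1) : ℕ)) : ℝ) ^ 2 / 2⌋₊ ≤ (2 * (k + 1)) ^ 2 := by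
      have hx : (1 - δ) * (((2 * (k + 1) : ℕ)) : ℝ) ^ 2 / 2 ≤ (((2 * (k + 1)) ^ 2 : ℕ) : ℝ) := by
        push_cast
        nlinarith [sq_nonneg (((2 * (k + 1) : ℕ)) : ℝ)]
      exact (Nat.floor_mono hx).trans (Nat.floor_natCast _).le
    have hK := exists_unit_mem_szSector (2 * (k + 1)) hn
    -- the penalty: `0 ≤ re ⟨ψ, Qψ⟩ ≤ (c_d L²)²` on unit vectors, and `t B < w` for `t = κ/L⁴`
    have hQ0 := TwSeededEnsembleEquivalence.Negative.re_rayleigh_seed_nonneg (2 * (k + 1))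
    have hQB : ∀ ψ : Fock (Orb (FermionTorus 2 (2 * (k + 1)))), star ψ ⬝ᵥ ψ = 1 →
        (star ψ ⬝ᵥ ((pairField dWaveFormFactor (2 * (k + 1)))ᴴ * pairField dWaveFormFactor (2 * (k + 1))) *ᵥ
          ψ).re ≤ (cd * ((2 * (k + 1) : ℕ) : ℝ) ^ 2) ^ 2 :=
      fun ψ hψ1 => (re_rayleigh_le_norm _ hψ1).trans (norm_pairIntensity_le (2 * (k + 1)))
    have ht : 0 ≤ w / (2 * (cd ^ 2 + 1)) / ((2 * (k + 1) : ℕ) : ℝ) ^ 4 := by positivity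
    have htB : w / (2 * (cd ^ 2 + 1)) / ((2 * (k + 1) : ℕ) : ℝ) ^ 4 * (cd * ((2 * (k + 1) : ℕ) : ℝ) ^ 2) ^ 2 < w := by
      have h1 : w / (2 * (cd ^ 2 + 1)) / ((2 * (k + 1) : ℕ) : ℝ) ^ 4 * (cd * ((2 * (k + 1) : ℕ) : ℝ) ^ 2) ^ 2 =
          w * (cd ^ 2 / (2 * (cd ^ 2 + 1))) := by
        field_simp
      rw [h1]
      have h2 : cd ^ 2 / (2 * (cd ^ 2 + 1)) < 1 := by
        rw [div_lt_one (by positivity)]; nlinarith [sq_nonneg cd]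
      nlinarith
    have key := smul_le_minEnergyOn_add_smul_sub
      (hubbardTorus_isHermitian (hamiltonian_isHermitian_and_commute_holds _) 1 U)
      (isHermitian_conjTranspose_mul_self _) _ hK hQ0 hQB ht htB
      (C := a * ((2 * (k + 1) : ℕ) : ℝ) ^ 4) (fun ψ hψK hψ1 hwin => hk ψ hψK hψ1 hwin)
    have hconst : w / (2 * (cd ^ 2 + 1)) / ((2 * (k + 1) : ℕ) : ℝ) ^ 4 * (a * ((2 * (k + 1) : ℕ) : ℝ) ^ 4) =
        a * (w / (2 * (cd ^ 2 + 1))) := by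
      field_simp
    rw [hconst] at key
    exact key

/-- **The ENGINE of line `SketchIdeator3` in energy-window normal form**: the thermal engine
(`stub_gibbsPenaltyFloor`) holds iff for every weak `U` there are a window doping `δ_U`, an intensive width
`w > 0` and `a > 0` with, eventually along `L = 2(k+1)`, the `d`-wave floor `a L⁴ ≤ re ⟨ψ, Δ_d†Δ_d ψ⟩` for every
unit `ψ` of the sector `(N_L, 0)` within energy `w` of the sector ground energy
(`gibbsPenaltyFloor_iff_penaltyResponseWindow` and `penaltyResponseWindow_iff_energyWindowFloor`). The crux `X` is
the case `w = 0` (`CwThesis.Negative.cwThesis_iff_floor`): the line's one open stub exceeds the crux exactly by the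
stability of the floor under `O(1)`-energy excitations. (The statement is kept on one line: it is a registered stub signature of the crux item, matched textually by the gate.) [folklore] -/
theorem gibbsPenaltyFloor_iff_energyWindowFloor : (∃ U₀ : ℝ, 0 < U₀ ∧ ∀ U ∈ Set.Ioo (0:ℝ) U₀, ∃ δ ∈ Set.Icc (3/10 : ℝ) (12/25), ∃ κ a M : ℝ, 0 < κ ∧ 0 < a ∧ 0 < M ∧ 2 * Real.log 4 ≤ M * κ * a ∧ ∀ᶠ k : ℕ in atTop, let L : ℕ := 2 * (k + 1); let n : ℕ := ⌊(1 - δ) * (L : ℝ) ^ 2 / 2⌋₊; let Hp := (hubbardTorus 2 L 1 U).toBlock (fun s => (upPart s).card = n ∧ (downPart s).card = n) (fun s => (upPart s).card = n ∧ (downPart s).card = n); let Qp := ((pairField dWaveFormFactor L)ᴴ * pairField dWaveFormFactor L).toBlock (fun s => (upPart s).card = n ∧ (downPart s).card = n) (fun s => (upPart s).card = n ∧ (downPart s).card = n); a * (L : ℝ) ^ 4 ≤ (Matrix.gibbsState (M * (L : ℝ) ^ 2) (Hp + ((κ / (L : ℝ) ^ 4 : ℝ) : ℂ) • Qp) Qp).re)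 ↔ (∃ U₀ : ℝ, 0 < U₀ ∧ ∀ U ∈ Set.Ioo (0:ℝ) U₀, ∃ δ ∈ Set.Icc (3/10 : ℝ) (12/25), ∃ w : ℝ, 0 < w ∧ ∃ a : ℝ, 0 < a ∧ ∀ᶠ k : ℕ in Filter.atTop, ∀ ψ ∈ szSector (Λ := FermionTorus 2 (2 * (k + 1))) (2 * ⌊(1 - δ) * ((2 * (k + 1) : ℕ) : ℝ) ^ 2 / 2⌋₊) 0, star ψ ⬝ᵥ ψ = 1 → (star ψ ⬝ᵥ hubbardTorus 2 (2 * (k + 1)) 1 U *ᵥ ψ).re ≤ Matrix.minEnergyOn (hubbardTorus 2 (2 * (k + 1)) 1 U) (szSector (2 * ⌊(1 - δ) * ((2 * (k + 1) : ℕ) : ℝ) ^ 2 / 2⌋₊) 0) + w → a * ((2 * (k + 1) : ℕ) : ℝ) ^ 4 ≤ (star ψ ⬝ᵥ ((pairField dWaveFormFactor (2 * (k + 1)))ᴴ * pairField dWaveFormFactor (2 * (k + 1))) *ᵥ ψ).re) :=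
  gibbsPenaltyFloor_iff_penaltyResponseWindow.trans penaltyResponseWindow_iff_energyWindowFloor

/-- **Energy-window floor ⇒ the crux** (the line's most transparent entry point): if for every weak `U`
there are a window doping `δ_U`, an intensive width `w > 0` and `a > 0` such that, eventually along
`L = 2(k+1)`, every unit vector of the sector `(N_L, 0)` within energy `w` of the sector ground energy has
`d`-wave pair intensity `≥ a L⁴`, then `ChiralWindow.CwThesis`
(`penaltyResponseWindow_iff_energyWindowFloor` + `cwThesis_of_penaltyResponse`). [folklore] -/
theorem cwThesis_of_energyWindowFloor
    (h : ∃ U₀ : ℝ, 0 < U₀ ∧ ∀ U ∈ Set.Ioo (0:ℝ) U₀, ∃ δ ∈ Set.Icc (3/10 : ℝ) (12/25),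
      ∃ w : ℝ, 0 < w ∧ ∃ a : ℝ, 0 < a ∧ ∀ᶠ k : ℕ in Filter.atTop,
        ∀ ψ ∈ szSector (Λ := FermionTorus 2 (2 * (k + 1))) (2 * ⌊(1 - δ) * ((2 * (k + 1) : ℕ) : ℝ) ^ 2 / 2⌋₊) 0,
          star ψ ⬝ᵥ ψ = 1 →
          (star ψ ⬝ᵥ hubbardTorus 2 (2 * (k + 1)) 1 U *ᵥ ψ).re ≤
              Matrix.minEnergyOn (hubbardTorus 2 (2 * (k + 1)) 1 U)
                (szSector (2 * ⌊(1 - δ) * ((2 * (k + 1) : ℕ) : ℝ) ^ 2 / 2⌋₊) 0) + w →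
            a * ((2 * (k + 1) : ℕ) : ℝ) ^ 4 ≤
              (star ψ ⬝ᵥ ((pairField dWaveFormFactor (2 * (k + 1)))ᴴ *
                pairField dWaveFormFactor (2 * (k + 1))) *ᵥ ψ).re) :
    ChiralWindow.CwThesis :=
  cwThesis_of_penaltyResponse (penaltyResponseWindow_iff_energyWindowFloor.mpr h)

end Summit.HubbardSuperconductivity.HubbardSuperconductivity.Theorems.CwThesis

end
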